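import Summits.QuantumFields.YangMills.Theorems.BalabanUVNodesN07CritTangentConverse
import Literature.MathematicalPhysics.QuantumFieldTheory.Balaban1983to89.Node00.LinearisedAveragingAtBackground

/-!
# BalabanUVNodes ∕ N07 — THE `k`-FOLD (0.4) AVERAGING OF RECORD IS A SUBMERSION AT EVERY GUARDED SMALL-FIELD BACKGROUND: the Fréchet derivative `Q_k(U₀) = dIterL k ↑U₀`
# of the matrix extension `iterM k` maps the tangent space `{Y·U₀ ∣ Y skew}` ONTO every `𝔰𝔲(N)`-valued right-chart target `Ū^k(U₀)·Z`, from the EXACT `k`-fold CORRECTOR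
# with linear rate (this lineage's MODULE 35c `exists_iter_eq_of_near_SU` over the route `UnitScaleTilt`'s one-step corrector) — the `𝔰𝔲(N)` half of def-Y's displayed
# letter `hQ : Function.Surjective (Node00.QOfRecord F N k U₀)` (`Node00/BgAveragingOfRecord` ✓p814239) at a CURVED background

Track A of `YM-PLAN.md` (cell `pub-ymgap`, HUMAN RULING D-0062), DAG node **N07** = [Balaban1985Variational].  Seat `pub-ymgap-dag-n07-e` (g38), CLAIM-2 (bus, 2026-08-31):
node00-def-Y g36's E1 word «`hQ` … general small `U₀` by [Balaban1985Averaging] Sect. E — a prover target (N07 side)»; split with dag-n07-w3 g24 (flat road `U₀ = 1` + plumbing,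
CLAIM-1).  `--kind proof --supports stmt-QuantumFields-27238 --as helper` (K0ᴬ, the M1 ∕ text (B) line's key of record); count-neutral.  THEOREMS ONLY (0 `def`).

THE MATHEMATICS (no estimate of Bałaban's is used or asserted; everything is calculus over the tree's own corrector).  Fix a torus `P`, `N`, a level `k ≤ m + K` and a background
`U₀ : GaugeField P 0 (SU N)` whose iterated averages `Ū^i(U₀)`, `i < k`, are `t₀`-plaquette-small with `stokesConst·t₀ < |I|⁻¹∕16` and `< δ_N` (the corrector's EXPLICIT
thresholds; no «`‖↑U₀ − 1‖ < ρ′`»: the hypothesis is gauge-invariant and holds at every member of the small-field class).  Let `V₀ := Ū^k(U₀)` and `Z : PBond P k → 𝔰𝔲(N)`.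
* The coarse curve `W(s) := V₀·exp(sZ)` (35a `expChart`) has matrix velocity `V₀·Z` and `‖↑W(s) − ↑V₀‖ = O(s)`.
* MODULE 35c's `k`-fold exact corrector (`N07CritTangentAtRecord.exists_iter_eq_of_near_SU`) gives, for small `s`, a fine field `U(s)` with `Ū^k(U(s)) = W(s)` EXACTLY and
  `‖↑U(s) − ↑U₀‖ ≤ (2∕|I|⁻¹)^k·‖↑W(s) − ↑V₀‖ = O(s)` — LOCAL SURJECTIVITY WITH LINEAR RATE of the nonlinear map `Ū^k` at `U₀`.
* §1 (pure calculus, `exists_tendsto_secant_of_hasFDerivAt`): if `f` has Fréchet derivative `D` at `x₀` (finite dimension), `‖x_n − x₀‖ ≤ C s_n`, `s_n ↓ 0`, and the secants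
  `s_n⁻¹(f x_n − f x₀) → w`, then a subsequence of `s_n⁻¹(x_n − x₀)` converges to some `h` with `D h = w` (Bolzano–Weierstrass + `f x_n − f x₀ − D(x_n − x₀) = o(s_n)`).
* Applied to `f := iterM k` (n07-w1 ✓`hasFDerivAt_iterM` under 35b's guard `SmallBelow`, supplied by 35e `smallBelow_of_plaqSmall`; `iterM k ↑U = ↑Ū^k(U)` on the guard, 35b
  `coeField_iter_eq_iterM`, the guard persisting along the corrected family by 35c `eventually_plaqSmall_iter_of_tendsto`): `dIterL k ↑U₀ h = V₀·Z`.
* TANGENCY OF THE LIMIT from unitarity alone: with `A = ↑U(s)_b`, `B = ↑U₀_b` unitary, `(A − B)B⋆ + B(A − B)⋆ = −(A − B)(A − B)⋆`, so the secant `u = s⁻¹(A − B)` satisfies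
  `uB⋆ + Bu⋆ = −s·uu⋆ → 0`; in the limit `hB⋆ + Bh⋆ = 0`, i.e. `Y_b := h_b·(↑U₀ b)⋆` is SKEW-HERMITIAN and `Y_b·↑U₀ b = h_b` (def-Y's LEFT chart `leftVel`, [Balaban1985Variational] (18)).
RESULT ★★★ `exists_skew_dIterL_eq_mul_of_plaqSmall`: `∃ Y` skew-Hermitian with `dIterL k ↑U₀ (b ↦ Y_b·↑U₀ b) = (c ↦ ↑V₀ c · ↑Z c)` — every `𝔰𝔲(N)`-direction at `V₀` is hit.  The
U(1)-PHASE directions (the trace line of def-Y's `𝔲(N)` real form — custodian remark I.23221) are the sibling module's (phase equivariance of the (0.4) average); the assembly to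
`Function.Surjective (QOfRecord F N k U₀)` is the third module.  §3 reads the result at NODE 00's objects (`avOfRecord F N K = blockAvg expMeanLogSU`, `rfl`).

HONEST FRAMING: count-neutral helper; real calculus over landed modules (35a∕35b∕35c∕35e, n07-w1's `dIterL`, the route `UnitScaleTilt`'s corrector BY NAME); the thresholds are the
corrector's (`|I|⁻¹∕16`, `δ_N`), NOT print's `O(L²α₀)`; nothing of [Balaban1985Averaging] Sect. E ∕ [Balaban1985BackgroundPropagators] asserted; `hQ` NOT yet discharged by this
file alone (trace line + assembly pending); `hpos` untouched; P0 OPEN; K0ᴬ∕K1ᴬ∕K3ᴬ OPEN; N07 NOT discharged; COUNT 8∕27 (A 8∕28) · K 1∕4 UNMOVED; one finite 𝕋⁴ programme at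
fixed `ε` — NOT continuum ∕ ℝ⁴ ∕ OS ∕ mass gap ∕ Clay.  No `sorry`, no `def`, no `instance`, no `notation`; standard axioms.
-/

noncomputable section

open scoped Matrix.Norms.L2Operator Topology
open Filter Asymptotics Function NormedSpace

namespace Summit.QuantumFields.YangMills.BalabanUVNodes.N07AveragingSubmersionSmallField

open Literature.MathematicalPhysics.QuantumFieldTheory.Balaban1983to89
open Literature.MathematicalPhysics.QuantumFieldTheory.Balaban1983to89.T4Continuum (T4Family)
open Literature.MathematicalPhysics.QuantumFieldTheory.Balaban1983to89.B15DeterminingSets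
open Literature.MathematicalPhysics.QuantumFieldTheory.Balaban1983to89.BlockAveraging
open Literature.MathematicalPhysics.QuantumFieldTheory.Balaban1983to89.BlockAveragingEMLHaarAC (emlWeight)
open Literature.MathematicalPhysics.QuantumFieldTheory.Balaban1983to89.ExpMeanLog (expMeanLogSU deltaSU deltaSU_pos)
open Literature.MathematicalPhysics.QuantumFieldTheory.Balaban1983to89.T4AdjointCovarianceUnitary (lieSU)
open Literature.MathematicalPhysics.QuantumFieldTheory.Balaban1983to89.Node00
open Summit.QuantumFields.YangMills.Theorems.BlockAvgCorrector (stokesConst stokesConst_nonneg emlWeight_pos emlWeight_le_one)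
open Summit.QuantumFields.YangMills.BalabanUVNodes.N07CritTangentAtRecord (exists_iter_eq_of_near_SU eventually_plaqSmall_iter_of_tendsto
  continuousAt_of_tendsto_coeField)
open Summit.QuantumFields.YangMills.BalabanUVNodes.N07CritTangentConverse (smallBelow_of_plaqSmall)

/-! ## §1  Secants under a Fréchet derivative (finite dimension) -/

section Secant

variable {E F : Type*} [NormedAddCommGroup E] [NormedSpace ℝ E] [ProperSpace E] [NormedAddCommGroup F] [NormedSpace ℝ F]

/-- **SECANTS WITH LINEAR RATE PASS TO THE DERIVATIVE.**  If `f` has Fréchet derivative `D` at `x₀`, `x_n → x₀` at a linear rate `‖x_n − x₀‖ ≤ C·s_n` along `s_n > 0`, `s_n → 0`, and the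
secants `s_n⁻¹(f x_n − f x₀)` converge to `w`, then some subsequence of the secants `s_n⁻¹(x_n − x₀)` converges to a vector `h` with `D h = w` (Bolzano–Weierstrass in the proper space
`E`; `f x_n − f x₀ − D(x_n − x₀) = o(‖x_n − x₀‖) = o(s_n)`).  The calculus step of «locally onto with linear rate ⇒ the derivative is onto». [folklore] -/
theorem exists_tendsto_secant_of_hasFDerivAt {f : E → F} {D : E →L[ℝ] F} {x₀ : E} (hf : HasFDerivAt f D x₀)
    {x : ℕ → E} {s : ℕ → ℝ} {C : ℝ} {w : F} (hs : ∀ n, 0 < s n) (hs0 : Tendsto s atTop (𝓝 0))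
    (hC : ∀ n, ‖x n - x₀‖ ≤ C * s n)
    (hw : Tendsto (fun n => (s n)⁻¹ • (f (x n) - f x₀)) atTop (𝓝 w)) :
    ∃ (h : E) (φ : ℕ → ℕ), StrictMono φ ∧ Tendsto (fun n => (s (φ n))⁻¹ • (x (φ n) - x₀)) atTop (𝓝 h) ∧ D h = w := by
  set u : ℕ → E := fun n => (s n)⁻¹ • (x n - x₀) with hu
  -- the secants are bounded
  have hub : ∀ n, ‖u n‖ ≤ C := by
    intro n
    rw [hu, norm_smul, norm_inv, Real.norm_of_nonneg (hs n).le]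
    rw [inv_mul_le_iff₀ (hs n)]
    calc ‖x n - x₀‖ ≤ C * s n := hC n
      _ = s n * C := mul_comm _ _
  have hmem : ∀ n, u n ∈ Metric.closedBall (0 : E) C := fun n => by
    rw [Metric.mem_closedBall, dist_zero_right]; exact hub n
  obtain ⟨h, -, φ, hφ, hlim⟩ := (isCompact_closedBall (0 : E) C).tendsto_subseq hmem
  refine ⟨h, φ, hφ, hlim, ?_⟩
  -- `x n → x₀`
  have hx : Tendsto x atTop (𝓝 x₀) := by
    rw [tendsto_iff_norm_sub_tendsto_zero]
    refine squeeze_zero (fun n => norm_nonneg _) hC ?_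
    simpa using hs0.const_mul C
  -- the remainder is `o(s n)`
  have hR : (fun n => f (x n) - f x₀ - D (x n - x₀)) =o[atTop] s := by
    have h1 : (fun n => f (x n) - f x₀ - D (x n - x₀)) =o[atTop] (fun n => x n - x₀) :=
      hf.isLittleO.comp_tendsto hx
    have h2 : (fun n => x n - x₀) =O[atTop] s :=
      IsBigO.of_bound C (Eventually.of_forall fun n => by
        rw [Real.norm_of_nonneg (hs n).le]; exact hC n)
    exact h1.trans_isBigO h2
  have hR0 : Tendsto (fun n => (s n)⁻¹ • (f (x n) - f x₀ - D (x n - x₀))) atTop (𝓝 0) := by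
    rw [NormedAddGroup.tendsto_nhds_zero]
    intro ε hε
    have := hR.def (half_pos hε)
    refine this.mono fun n hn => ?_
    rw [norm_smul, norm_inv, Real.norm_of_nonneg (hs n).le]
    rw [Real.norm_of_nonneg (hs n).le] at hn
    have hsn : (s n)⁻¹ * (ε / 2 * s n) = ε / 2 := by
      rw [mul_comm (ε / 2), ← mul_assoc, inv_mul_cancel₀ (hs n).ne', one_mul]
    calc (s n)⁻¹ * ‖f (x n) - f x₀ - D (x n - x₀)‖ ≤ (s n)⁻¹ * (ε / 2 * s n) :=
          mul_le_mul_of_nonneg_left hn (inv_nonneg.2 (hs n).le)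
      _ = ε / 2 := hsn
      _ < ε := half_lt_self hε
  -- hence `D (u n) → w`
  have hDu : Tendsto (fun n => D (u n)) atTop (𝓝 w) := by
    have heq : ∀ n, D (u n) = (s n)⁻¹ • (f (x n) - f x₀) - (s n)⁻¹ • (f (x n) - f x₀ - D (x n - x₀)) := by
      intro n
      rw [hu]
      simp only [map_smul, map_sub, smul_sub]
      abel
    simp_rw [heq]
    simpa using hw.sub hR0
  -- and along the subsequence `D (u (φ n)) → D h`
  have hDφ : Tendsto (fun n => D (u (φ n))) atTop (𝓝 (D h)) := (D.continuous.tendsto h).comp hlim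
  exact tendsto_nhds_unique hDφ (hDu.comp hφ.tendsto_atTop)

end Secant

/-! ## §2  The `𝔰𝔲(N)` directions of `Q_k(U₀)` at a guarded small-field background, by the exact `k`-fold corrector -/

section SmallField

variable {P : Params} {N : ℕ} [NeZero N]

omit [NeZero N] in
/-- **UNITARY SECANTS ARE ASYMPTOTICALLY TANGENT** (matrix identity): for unitary `A`, `B`, `(A − B)·B⋆ + B·(A − B)⋆ = −(A − B)·(A − B)⋆`. [folklore] -/
theorem sub_mul_star_add_mul_star_sub_of_unitary {A B : Matrix (Fin N) (Fin N) ℂ} (hA : A * star A = 1) (hB : B * star B = 1) :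
    (A - B) * star B + B * star (A - B) = -((A - B) * star (A - B)) := by
  simp only [star_sub, sub_mul, mul_sub, hA, hB]
  abel

/-- ★★★ **THE `𝔰𝔲(N)` DIRECTIONS OF `Q_k(U₀)` AT EVERY GUARDED SMALL-FIELD BACKGROUND ARE HIT FROM THE TANGENT SPACE** — for a torus `P`, a level `k ≤ m + K`, a background `U₀`
whose iterated (0.4) averages `Ū^i(U₀)`, `i < k`, are `t₀`-plaquette-small with `stokesConst·t₀ < |I|⁻¹∕16` and `< δ_N`, and every `Z : PBond P k → 𝔰𝔲(N)`: there is a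
SKEW-HERMITIAN fine field `Y` with `dIterL k ↑U₀ (b ↦ Y_b·↑U₀ b) = (c ↦ ↑Ū^k(U₀)(c) · ↑Z c)` — the Fréchet derivative of the matrix extension `iterM k` (n07-w1's `dIterL`, print's
`Q_k(U₀)` before trivialisation) maps def-Y's left-chart tangent vector `leftVel U₀ Y` to the right-chart velocity `V₀·Z`.  From MODULE 35c's exact `k`-fold corrector with linear
rate along the coarse curve `V₀·exp(sZ)`, §1's secant lemma (`iterM k` is Fréchet differentiable at `↑U₀` under the guard, n07-w1; `iterM k = ↑Ū^k` on the guard, 35b; the guard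
persists along the corrected family, 35c), and unitarity of the corrected fields (tangency of the limit secant).
[cite: Balaban1985Variational, (18) p.281, (44)–(45) p.285; Balaban1985BackgroundPropagators, (3.13)–(3.15) p.393; Balaban1987RG1, (0.4) p.253, (0.21) p.256] -/
theorem exists_skew_dIterL_eq_mul_of_plaqSmall {t₀ : ℝ} (ht₀ : 0 < t₀) (hst : stokesConst P * t₀ < emlWeight P / 16)
    (hstδ : stokesConst P * t₀ < deltaSU (Fin N)) {k : ℕ} (hk : k ≤ P.m + P.K) {U₀ : GaugeField P 0 (SU N)}
    (hsm : ∀ i, i < k → PlaqSmall t₀ (Averaging.iter (fun i => blockAvg (P := P) (j := i) (expMeanLogSU (n := Fin N))) i U₀))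
    (Z : PBond P k → lieSU (Fin N)) :
    ∃ Y : PBond P 0 → Matrix (Fin N) (Fin N) ℂ, (∀ b, star (Y b) = -Y b) ∧
      dIterL k (coeField U₀) (fun b => Y b * (U₀ b : Matrix (Fin N) (Fin N) ℂ)) =
        fun c => ((Averaging.iter (fun i => blockAvg (P := P) (j := i) (expMeanLogSU (n := Fin N))) k U₀ c : SU N) : Matrix (Fin N) (Fin N) ℂ) *
          (Z c : Matrix (Fin N) (Fin N) ℂ) := by
  classical
  set av : ∀ j, Averaging P j (SU N) := fun i => blockAvg (P := P) (j := i) (expMeanLogSU (n := Fin N)) with hav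
  set V₀ : GaugeField P k (SU N) := Averaging.iter av k U₀ with hV₀
  -- the coarse curve `W s = V₀·exp(sZ)` and its matrix form
  set W : ℝ → GaugeField P k (SU N) := fun s => expChart V₀ (s • Z) with hW
  have hW0 : W 0 = V₀ := by simp only [hW, zero_smul, expChart_zero]
  set w : PBond P k → Matrix (Fin N) (Fin N) ℂ := fun c => ((V₀ c : SU N) : Matrix (Fin N) (Fin N) ℂ) * (Z c : Matrix (Fin N) (Fin N) ℂ) with hw
  have hWderiv : HasDerivAt (fun s => coeField (W s)) w 0 := by
    rw [hasDerivAt_pi]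
    intro c
    exact hasDerivAt_coe_expChart_along (U := V₀) (c := fun s : ℝ => s • Z) (hasDerivAt_ray Z) (zero_smul ℝ Z) c
  have hWtend : Tendsto (fun s => coeField (W s)) (𝓝 0) (𝓝 (coeField V₀)) := by
    have h := hWderiv.continuousAt.tendsto
    rwa [hW0] at h
  -- the defect `η s = ‖↑W s − ↑V₀‖` is `O(s)` and tends to `0`
  set η : ℝ → ℝ := fun s => ‖coeField (W s) - coeField V₀‖ with hη
  have hη_nonneg : ∀ s, 0 ≤ η s := fun s => norm_nonneg _
  have hη0 : η 0 = 0 := by simp only [hη, hW0, sub_self, norm_zero]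
  have hηO : η =O[𝓝 0] fun s => s := by
    have h := hWderiv.isBigO_sub
    simp only [sub_zero, hW0] at h
    exact h.norm_left
  have hη_tendsto : Tendsto η (𝓝 0) (𝓝 0) := by
    have h := (hWtend.sub_const (coeField V₀)).norm
    simp only [sub_self, norm_zero] at h
    exact h
  obtain ⟨C, hCpos, hCbound⟩ := hηO.exists_pos
  have hCev : ∀ᶠ s in 𝓝 (0 : ℝ), η s ≤ C * ‖s‖ := by
    have h := hCbound.bound
    exact h.mono fun s hs => by rwa [Real.norm_of_nonneg (hη_nonneg s)] at hs
  -- constants of the corrector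
  have hκ : 0 < emlWeight P := emlWeight_pos P
  set q : ℝ := (2 / emlWeight P) ^ k with hq
  have hq0 : 0 ≤ q := pow_nonneg (div_nonneg (by norm_num) hκ.le) k
  -- the quantitative conditions of the corrector hold for `s` near `0`
  have hgood : ∀ᶠ s in 𝓝 (0 : ℝ), stokesConst P * t₀ + q * η s ≤ emlWeight P / 16 ∧ stokesConst P * t₀ + q * η s < deltaSU (Fin N) := by
    have hlin : Tendsto (fun s => stokesConst P * t₀ + q * η s) (𝓝 0) (𝓝 (stokesConst P * t₀ + q * 0)) :=
      tendsto_const_nhds.add (tendsto_const_nhds.mul hη_tendsto)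
    rw [mul_zero, add_zero] at hlin
    exact (hlin.eventually (eventually_le_nhds hst)).and (hlin.eventually (eventually_lt_nhds hstδ))
  -- the corrected fields: `Ū^k(U′) = W s` exactly, `‖↑U′ − ↑U₀‖ ≤ q·η s`
  have hcorr : ∀ s, stokesConst P * t₀ + q * η s ≤ emlWeight P / 16 → stokesConst P * t₀ + q * η s < deltaSU (Fin N) →
      ∃ U' : GaugeField P 0 (SU N), Averaging.iter av k U' = W s ∧
        ∀ b, ‖((U' b : SU N) : Matrix (Fin N) (Fin N) ℂ) - (U₀ b : Matrix (Fin N) (Fin N) ℂ)‖ ≤ q * η s := by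
    intro s h2 h3
    refine exists_iter_eq_of_near_SU ht₀.le k hk U₀ hsm (η s) (hη_nonneg s) h2 h3 (W s) fun c => ?_
    exact norm_le_pi_norm (coeField (W s) - coeField V₀) c
  set Uc : ℝ → GaugeField P 0 (SU N) := fun s =>
    if h : stokesConst P * t₀ + q * η s ≤ emlWeight P / 16 ∧ stokesConst P * t₀ + q * η s < deltaSU (Fin N)
    then Classical.choose (hcorr s h.1 h.2) else U₀ with hUc
  have hUc_spec : ∀ s, ∀ h : stokesConst P * t₀ + q * η s ≤ emlWeight P / 16 ∧ stokesConst P * t₀ + q * η s < deltaSU (Fin N),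
      Averaging.iter av k (Uc s) = W s ∧ ∀ b, ‖((Uc s b : SU N) : Matrix (Fin N) (Fin N) ℂ) - (U₀ b : Matrix (Fin N) (Fin N) ℂ)‖ ≤ q * η s := by
    intro s h
    have hs : Uc s = Classical.choose (hcorr s h.1 h.2) := by rw [hUc]; exact dif_pos h
    rw [hs]
    exact Classical.choose_spec (hcorr s h.1 h.2)
  have hUc_dist : ∀ s, ‖coeField (Uc s) - coeField U₀‖ ≤ q * η s := by
    intro s
    by_cases h : stokesConst P * t₀ + q * η s ≤ emlWeight P / 16 ∧ stokesConst P * t₀ + q * η s < deltaSU (Fin N)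
    · exact (pi_norm_le_iff_of_nonneg (mul_nonneg hq0 (hη_nonneg s))).2 fun b => (hUc_spec s h).2 b
    · have hs : Uc s = U₀ := by rw [hUc]; exact dif_neg h
      rw [hs, sub_self, norm_zero]
      exact mul_nonneg hq0 (hη_nonneg s)
  have hUc0 : Uc 0 = U₀ := by
    have h := hUc_dist 0
    rw [hη0, mul_zero] at h
    have h' : coeField (Uc 0) = coeField U₀ := sub_eq_zero.1 (norm_le_zero_iff.1 h)
    funext b
    exact Subtype.ext (congrFun h' b)
  have hUc_tend : Tendsto (fun s => coeField (Uc s)) (𝓝 0) (𝓝 (coeField (Uc 0))) := by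
    rw [hUc0, tendsto_iff_norm_sub_tendsto_zero]
    refine squeeze_zero (fun s => norm_nonneg _) hUc_dist ?_
    simpa using hη_tendsto.const_mul q
  -- the guard persists along the corrected family
  have hguard : ∀ᶠ s in 𝓝 (0 : ℝ), ∀ i, i < k → PlaqSmall t₀ (Averaging.iter av i (Uc s)) :=
    eventually_plaqSmall_iter_of_tendsto ht₀ hstδ hUc_tend (k := k) (by rw [hUc0]; exact hsm)
  -- a positive sequence inside the good neighbourhood
  obtain ⟨ε, hε, hball⟩ := Metric.eventually_nhds_iff.1 (hgood.and (hCev.and hguard))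
  set s : ℕ → ℝ := fun n => ε / ((n : ℝ) + 2) with hsdef
  have hs_pos : ∀ n, 0 < s n := fun n => div_pos hε (by positivity)
  have hs_lt : ∀ n, s n < ε := fun n => by
    rw [hsdef]
    exact div_lt_self hε (by linarith [(Nat.cast_nonneg n : (0 : ℝ) ≤ n)])
  have hs_mem : ∀ n, dist (s n) 0 < ε := fun n => by
    rw [dist_zero_right, Real.norm_of_nonneg (hs_pos n).le]; exact hs_lt n
  have hs0 : Tendsto s atTop (𝓝 0) := by
    have h1 : Tendsto (fun n : ℕ => (n : ℝ) + 2) atTop atTop := tendsto_natCast_atTop_atTop.atTop_add tendsto_const_nhds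
    exact tendsto_const_nhds.div_atTop h1
  have hgood_n : ∀ n, stokesConst P * t₀ + q * η (s n) ≤ emlWeight P / 16 ∧ stokesConst P * t₀ + q * η (s n) < deltaSU (Fin N) :=
    fun n => (hball (hs_mem n)).1
  have hC_n : ∀ n, η (s n) ≤ C * s n := fun n => by
    have h := (hball (hs_mem n)).2.1
    rwa [Real.norm_of_nonneg (hs_pos n).le] at h
  have hguard_n : ∀ n, ∀ i, i < k → PlaqSmall t₀ (Averaging.iter av i (Uc (s n))) := fun n => (hball (hs_mem n)).2.2
  -- the Fréchet derivative of `iterM k` at `↑U₀` and the identification `iterM k ↑U = ↑Ū^k(U)` on the guard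
  have hSB0 : SmallBelow av k U₀ := smallBelow_of_plaqSmall ht₀ hstδ hsm
  have hf : HasFDerivAt (iterM k : (PBond P 0 → Matrix (Fin N) (Fin N) ℂ) → PBond P k → Matrix (Fin N) (Fin N) ℂ) (dIterL k (coeField U₀)) (coeField U₀) :=
    hasFDerivAt_iterM k hSB0
  have hf0 : iterM k (coeField U₀) = coeField V₀ := (coeField_iter_eq_iterM k hSB0).symm
  have hfn : ∀ n, iterM k (coeField (Uc (s n))) = coeField (W (s n)) := by
    intro n
    rw [← coeField_iter_eq_iterM k (smallBelow_of_plaqSmall ht₀ hstδ (hguard_n n)), (hUc_spec (s n) (hgood_n n)).1]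
  -- the secants of `f` converge to `w`
  have hsec : Tendsto (fun n => (s n)⁻¹ • (iterM k (coeField (Uc (s n))) - iterM k (coeField U₀))) atTop (𝓝 w) := by
    have h1 : Tendsto (fun t => t⁻¹ • (coeField (W (0 + t)) - coeField (W 0))) (𝓝[≠] 0) (𝓝 w) := hWderiv.tendsto_slope_zero
    simp only [zero_add, hW0] at h1
    have h2 : Tendsto s atTop (𝓝[≠] 0) :=
      tendsto_nhdsWithin_of_tendsto_nhds_of_eventually_within s hs0 (Eventually.of_forall fun n => (hs_pos n).ne')
    have h3 := h1.comp h2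
    refine h3.congr fun n => ?_
    simp only [Function.comp_apply, hfn, hf0]
  -- §1: a limit secant `h` with `D h = w`
  obtain ⟨h, φ, hφ, hlim, hDh⟩ := exists_tendsto_secant_of_hasFDerivAt hf (x := fun n => coeField (Uc (s n))) hs_pos hs0
    (C := q * C) (fun n => (hUc_dist (s n)).trans (by rw [mul_assoc]; exact mul_le_mul_of_nonneg_left (hC_n n) hq0)) hsec
  -- tangency of the limit: `h_b·(U₀ b)⋆ + (U₀ b)·h_b⋆ = 0`
  have htan : ∀ b, h b * star ((U₀ b : SU N) : Matrix (Fin N) (Fin N) ℂ) + ((U₀ b : SU N) : Matrix (Fin N) (Fin N) ℂ) * star (h b) = 0 := by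
    intro b
    set B : Matrix (Fin N) (Fin N) ℂ := ((U₀ b : SU N) : Matrix (Fin N) (Fin N) ℂ) with hB
    have hBu : B * star B = 1 := Matrix.mem_unitaryGroup_iff.mp (Matrix.mem_specialUnitaryGroup_iff.mp (U₀ b).2).1
    -- the secant at bond `b` along the subsequence, and the continuous quadratic test map
    set ub : ℕ → Matrix (Fin N) (Fin N) ℂ := fun n => (s (φ n))⁻¹ • (((Uc (s (φ n)) b : SU N) : Matrix (Fin N) (Fin N) ℂ) - B) with hub
    have hub_tend : Tendsto ub atTop (𝓝 (h b)) := by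
      have h1 := ((continuous_apply b).tendsto h).comp hlim
      refine h1.congr fun n => ?_
      simp only [Function.comp_apply, Pi.smul_apply, Pi.sub_apply, coeField_apply, hub, hB]
    set g : Matrix (Fin N) (Fin N) ℂ → Matrix (Fin N) (Fin N) ℂ := fun u => u * star B + B * star u with hg
    have hg_cont : Continuous g := (continuous_id.mul continuous_const).add (continuous_const.mul continuous_id.star)
    have hg_lim : Tendsto (fun n => g (ub n)) atTop (𝓝 (g (h b))) := (hg_cont.tendsto (h b)).comp hub_tend
    -- `g (ub n) = s⁻¹·(−(A − B)(A − B)⋆)` has norm `≤ (qC)²·s → 0`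
    have hg_bound : ∀ n, ‖g (ub n)‖ ≤ (q * C) ^ 2 * s (φ n) := by
      intro n
      set A : Matrix (Fin N) (Fin N) ℂ := ((Uc (s (φ n)) b : SU N) : Matrix (Fin N) (Fin N) ℂ) with hA
      have hAu : A * star A = 1 := Matrix.mem_unitaryGroup_iff.mp (Matrix.mem_specialUnitaryGroup_iff.mp (Uc (s (φ n)) b).2).1
      have hsφ : 0 < s (φ n) := hs_pos (φ n)
      have hAB : ‖A - B‖ ≤ (q * C) * s (φ n) := by
        have h1 : ‖A - B‖ ≤ q * η (s (φ n)) := (norm_le_pi_norm (coeField (Uc (s (φ n))) - coeField U₀) b).trans (hUc_dist (s (φ n)))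
        exact h1.trans (by rw [mul_assoc]; exact mul_le_mul_of_nonneg_left (hC_n (φ n)) hq0)
      have hcoe : ub n = ((s (φ n))⁻¹ : ℂ) • (A - B) := by
        show (s (φ n))⁻¹ • (A - B) = _
        rw [← Complex.coe_smul, Complex.ofReal_inv]
      have hgub : g (ub n) = ((s (φ n))⁻¹ : ℂ) • (-((A - B) * star (A - B))) := by
        simp only [hg, hcoe, star_smul, Complex.star_def, ← Complex.ofReal_inv, Complex.conj_ofReal, smul_mul_assoc, mul_smul_comm, ← smul_add]
        rw [sub_mul_star_add_mul_star_sub_of_unitary hAu hBu]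
      rw [hgub, norm_smul, norm_neg, norm_inv, Complex.norm_real, Real.norm_of_nonneg hsφ.le]
      have hprod : ‖(A - B) * star (A - B)‖ ≤ ‖A - B‖ * ‖A - B‖ := by
        refine (norm_mul_le _ _).trans ?_
        rw [Matrix.star_eq_conjTranspose, Matrix.l2_opNorm_conjTranspose]
      have hAB0 : 0 ≤ ‖A - B‖ := norm_nonneg _
      calc (s (φ n))⁻¹ * ‖(A - B) * star (A - B)‖ ≤ (s (φ n))⁻¹ * ((q * C) * s (φ n) * ((q * C) * s (φ n))) := by
            refine mul_le_mul_of_nonneg_left (hprod.trans ?_) (inv_nonneg.2 hsφ.le)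
            exact mul_le_mul hAB hAB hAB0 ((norm_nonneg _).trans hAB)
        _ = (q * C) ^ 2 * s (φ n) := by field_simp
    have hg_zero : Tendsto (fun n => g (ub n)) atTop (𝓝 0) := by
      rw [tendsto_iff_norm_sub_tendsto_zero]
      simp only [sub_zero]
      refine squeeze_zero (fun n => norm_nonneg _) hg_bound ?_
      simpa using (hs0.comp hφ.tendsto_atTop).const_mul ((q * C) ^ 2)
    have hgh : g (h b) = 0 := tendsto_nhds_unique hg_lim hg_zero
    simpa only [hg] using hgh
  -- the skew field `Y_b := h_b·(U₀ b)⋆`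
  refine ⟨fun b => h b * star ((U₀ b : SU N) : Matrix (Fin N) (Fin N) ℂ), fun b => ?_, ?_⟩
  · have h1 := htan b
    rw [star_mul, star_star]
    exact (eq_neg_of_add_eq_zero_right h1)
  · have hY : (fun b => h b * star ((U₀ b : SU N) : Matrix (Fin N) (Fin N) ℂ) * ((U₀ b : SU N) : Matrix (Fin N) (Fin N) ℂ)) = h := by
      funext b
      have hBu' : star ((U₀ b : SU N) : Matrix (Fin N) (Fin N) ℂ) * ((U₀ b : SU N) : Matrix (Fin N) (Fin N) ℂ) = 1 :=
        Matrix.mem_unitaryGroup_iff'.mp (Matrix.mem_specialUnitaryGroup_iff.mp (U₀ b).2).1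
      rw [mul_assoc, hBu', mul_one]
    rw [hY, hDh]

end SmallField

/-! ## §3  At NODE 00's objects (`avOfRecord F N K = blockAvg expMeanLogSU`, `rfl`) -/

section Record

variable {F : T4Family} {N : ℕ} [NeZero N]

/-- ★★★ **AT NODE 00's OBJECTS**: on the torus `F.P K` with the averaging of record `avOfRecord F N K`, at a level `k ≤ m + K` and a background `U₀` with `t₀`-plaquette-small iterated
averages below `k` (`stokesConst·t₀ < |I|⁻¹∕16`, `< δ_N`), every `𝔰𝔲(N)`-valued right-chart target `Ū^k(U₀)·Z` is `Q_k(U₀)` of a skew-Hermitian left-chart tangent vector `Y·U₀`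
(§2 verbatim; `avOfRecord F N K j = blockAvg expMeanLogSU` by `rfl`). [cite: Balaban1985Variational, (18) p.281, (44)–(45) p.285; Balaban1985BackgroundPropagators, (3.13)–(3.15) p.393; Balaban1987RG1, (0.4) p.253, (0.21) p.256] -/
theorem exists_skew_dIterL_eq_mul_of_plaqSmall_avOfRecord {K k : ℕ} (hk : k ≤ (F.P K).m + (F.P K).K) {t₀ : ℝ} (ht₀ : 0 < t₀)
    (hst : stokesConst (F.P K) * t₀ < emlWeight (F.P K) / 16) (hstδ : stokesConst (F.P K) * t₀ < deltaSU (Fin N)) {U₀ : GaugeField (F.P K) 0 (SU N)}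
    (hsm : ∀ i, i < k → PlaqSmall t₀ (Averaging.iter (avOfRecord F N K) i U₀)) (Z : PBond (F.P K) k → lieSU (Fin N)) :
    ∃ Y : PBond (F.P K) 0 → Matrix (Fin N) (Fin N) ℂ, (∀ b, star (Y b) = -Y b) ∧
      dIterL k (coeField U₀) (fun b => Y b * (U₀ b : Matrix (Fin N) (Fin N) ℂ)) =
        fun c => ((Averaging.iter (avOfRecord F N K) k U₀ c : SU N) : Matrix (Fin N) (Fin N) ℂ) * (Z c : Matrix (Fin N) (Fin N) ℂ) :=
  exists_skew_dIterL_eq_mul_of_plaqSmall ht₀ hst hstδ hk hsm Z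

end Record

end Summit.QuantumFields.YangMills.BalabanUVNodes.N07AveragingSubmersionSmallField

end
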